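import Mathlib
import Summits.Ventures.HodgeRepro2.T5RecordSatakeDiscriminant
import Summits.Ventures.HodgeRepro2.T5SexticGaloisCMHecke

/-!
# THE BRIEF'S SEXTIC GALOIS CM CASE OUTSIDE THE DISCRIMINANT: THE EXCEPTIONAL SET IS `{p ∣ disc K}`

Tier-5 support N3 / §G-N4.2 (seat p3, gen 83). File 317 settles the Hecke side of the brief's «sextic Galois CM
case» at every prime `p` UNRAMIFIED in `K` (`e(P/p) = 1`): commutative at the place `v` under `P`, `k[X]` exactly
when `f(P/p)` is even. File 322 reads «unramified» off the one integer `disc K`. Together, for every sextic Galois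
CM field `K` (cyclic by file 280), every integral unimodular hermitian `H`, every rational prime `p ∤ disc K`, every
place `v` of `K⁺` above `p` and every prime `P` of `K` above `v`:

* **`ramificationIdx_eq_one_of_not_dvd_discr`** — `e(P/p) = 1` (file 322 at the place `P`);
* **`sextic_galois_cm_hecke_outside_discriminant`** — `H(U(1 ⊗ H), K_v)` is commutative, and if `f(P/p)` is even
  it is `k[X]` and the Satake chain holds with numerals `q = p^{f(v/p)}`, `f(v/p) = f(P/p) / 2` — the sextic case
  of the brief with the exceptional set `{p ∣ disc K}` (files 281 / 285: `f(P/p) ∈ {2, 6}` there, `q ∈ {p, p³}`);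
* **`ncard_primesOver_eq_one_iff_even`** — one prime of `K` above `v` iff `f(P/p)` is even, there.

§8(d): uses an L-value-free non-vanishing device: NO.
-/

open Matrix NumberField NumberField.IsCMField IsDedekindDomain IsDedekindDomain.HeightOneSpectrum Module Polynomial
  Ideal
open scoped TensorProduct Pointwise
open Summit.Ventures.HodgeRepro2.T5UnitaryGroupForm Summit.Ventures.HodgeRepro2.T5UnitaryHeckeAdjoint
  Summit.Ventures.HodgeRepro2.T5HeckePermutationModule Summit.Ventures.HodgeRepro2.T5HeckeDoubleCoset
  Summit.Ventures.HodgeRepro2.T5RecordHyperspecial Summit.Ventures.HodgeRepro2.T5GlobalLatticeAlmostAll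
  Summit.Ventures.HodgeRepro2.T5FinitePlaceSplitClassification Summit.Ventures.HodgeRepro2.T5RecordSatakeIntrinsic
  Summit.Ventures.HodgeRepro2.T5SplitPlaceUnitaryGroup Summit.Ventures.HodgeRepro2.T5NonSplitPlaceUnitaryGroup
  Summit.Ventures.HodgeRepro2.T5FinitePlaceCM Summit.Ventures.HodgeRepro2.T5StarOfInvolution
  Summit.Ventures.HodgeRepro2.T5CyclotomicSubfieldHeckeCommutative
  Summit.Ventures.HodgeRepro2.T5IntegralGramBadSet Summit.Ventures.HodgeRepro2.T5RecordSatakeDifferent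
  Summit.Ventures.HodgeRepro2.T5CyclotomicTwentyOneSatake Summit.Ventures.HodgeRepro2.T5CyclotomicSevenHeckeCommutative
  Summit.Ventures.HodgeRepro2.T5RecordDifferentTower Summit.Ventures.HodgeRepro2.T5RecordUnramifiedEveryCMField
  Summit.Ventures.HodgeRepro2.T5RecordSatakeDiscriminant Summit.Ventures.HodgeRepro2.T5SexticGaloisCMHecke
  Summit.Ventures.HodgeRepro2.T5CMFieldCyclicGaloisCriterion

namespace Summit.Ventures.HodgeRepro2.T5SexticGaloisCMDiscriminant

section Unramified

variable (K : Type*) [Field K] [NumberField K] [IsCMField K]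
variable (p : ℕ) (hp : ¬ (p : ℤ) ∣ discr K)
variable (v : HeightOneSpectrum (𝓞 (maximalRealSubfield K))) [hvp : v.asIdeal.LiesOver (span {(p : ℤ)})]
variable (P : Ideal (𝓞 K)) [hP : P.IsPrime] [hPv : P.LiesOver v.asIdeal]

include hp hvp in
omit [IsCMField K] hP hPv in
/-- **`disc K ∉ v` at a place `v` above `p ∤ disc K`** (`v ∩ ℤ = pℤ`). -/
theorem discr_notMem_of_not_dvd_discr : ((discr K : ℤ) : 𝓞 (maximalRealSubfield K)) ∉ v.asIdeal := by
  intro hmem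
  have hunder : (discr K : ℤ) ∈ v.asIdeal.under ℤ := by
    rw [Ideal.under, Ideal.mem_comap, algebraMap_int_eq, eq_intCast]
    exact hmem
  rw [← hvp.over] at hunder
  exact hp (Ideal.mem_span_singleton.mp hunder)

include hp hvp hPv in
omit [IsCMField K] in
/-- **`e(P/p) = 1` for every prime `P` of `K` above a place `v` of `K⁺` above a rational prime `p ∤ disc K`**
(file 322 at the place `placeOf K P v`). -/
theorem ramificationIdx_eq_one_of_not_dvd_discr : P.ramificationIdx ℤ = 1 :=
  haveI : (placeOf K P v).asIdeal.LiesOver v.asIdeal := hPv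
  ramificationIdx_int_eq_one_of_discr_notMem' K v (placeOf K P v) (discr_notMem_of_not_dvd_discr K p hp v)

end Unramified

section Sextic

variable (K : Type*) [Field K] [NumberField K] [IsCMField K] [IsGalois ℚ K] (h6 : Module.finrank ℚ K = 6)
variable (p : ℕ) [hp : Fact p.Prime] (hpd : ¬ (p : ℤ) ∣ discr K)
variable (v : HeightOneSpectrum (𝓞 (maximalRealSubfield K))) [hvp : v.asIdeal.LiesOver (span {(p : ℤ)})]
variable (P : Ideal (𝓞 K)) [hP : P.IsPrime] [hPp : P.LiesOver (span {(p : ℤ)})] [hPv : P.LiesOver v.asIdeal]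
variable {r : ℕ} (l : Fin r → 𝓞 K) (k : Type*) [Field k] [CharZero k]
  (hl : Submodule.span (𝓞 (maximalRealSubfield K)) (Set.range l) = ⊤)
variable (M : Matrix (Fin 3) (Fin 3) (𝓞 K)) (hM : IsUnit M.det)
  (hH : ((algebraMap (𝓞 K) K).mapMatrix M).IsHermitian)

include h6 hpd hvp hPp hPv in
/-- **One prime of `K` above `v` iff `f(P/p)` is even**, at every place above `p ∤ disc K` (file 281's criterion for
the cyclic Galois group of a sextic Galois CM field, with `e(P/p) = 1` from the discriminant). -/
theorem ncard_primesOver_eq_one_iff_even :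
    (v.asIdeal.primesOver (𝓞 K)).ncard = 1 ↔ Even (P.inertiaDeg ℤ) :=
  haveI := isCyclic_gal K h6
  ncard_primesOver_eq_one_iff_even_inertiaDeg K p P v (ramificationIdx_eq_one_of_not_dvd_discr K p hpd v P)

include h6 hpd hvp hPp hPv hl hM hH in
/-- **THE BRIEF'S SEXTIC GALOIS CM CASE OUTSIDE THE DISCRIMINANT**: for every sextic Galois CM field `K`, every
integral unimodular hermitian `H`, every rational prime `p ∤ disc K`, every place `v` of `K⁺` above `p` and every
prime `P` of `K` above `v`: `e(P/p) = 1`; the record's spherical Hecke algebra `H(U(1 ⊗ H), K_v)` is commutative;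
and if `f(P/p)` is even, `v` has one prime of `K` above it, the algebra is `k[X]` and the Satake chain holds with
numerals `q = p^{f(v/p)}` — the exceptional set of the brief's case is `{p ∣ disc K}`. -/
theorem sextic_galois_cm_hecke_outside_discriminant :
    P.ramificationIdx ℤ = 1 ∧
    RecordCommutative K v l k ((algebraMap (𝓞 K) K).mapMatrix M) ∧
    (Even (P.inertiaDeg ℤ) →
      (v.asIdeal.primesOver (𝓞 K)).ncard = 1 ∧
      RecordPolynomial K v l k ((algebraMap (𝓞 K) K).mapMatrix M) ∧
      ChainNumerals K v l k ((algebraMap (𝓞 K) K).mapMatrix M) (p ^ v.asIdeal.inertiaDeg ℤ)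
        ((p ^ v.asIdeal.inertiaDeg ℤ) ^ 3 + 1) ((p ^ v.asIdeal.inertiaDeg ℤ) ^ 4)
        ((p ^ v.asIdeal.inertiaDeg ℤ) ^ 4 + p ^ v.asIdeal.inertiaDeg ℤ)) := by
  have hv : ((discr K : ℤ) : 𝓞 (maximalRealSubfield K)) ∉ v.asIdeal :=
    discr_notMem_of_not_dvd_discr K p hpd v
  refine ⟨ramificationIdx_eq_one_of_not_dvd_discr K p hpd v P,
    recordCommutative_of_discr_notMem K v l k hl hv hH (isUnit_det_mapMatrix M hM)
      (forall_notMem_badSet_mapMatrix v M hM), fun heven => ?_⟩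
  have h1 : (v.asIdeal.primesOver (𝓞 K)).ncard = 1 :=
    (ncard_primesOver_eq_one_iff_even K h6 p hpd v P).mpr heven
  exact ⟨h1, recordPolynomial_of_discr_notMem K v l k hl hv h1 hH (isUnit_det_mapMatrix M hM)
      (forall_notMem_badSet_mapMatrix v M hM),
    chainNumerals_of_discr_notMem K v l k hl p hv h1 hH (isUnit_det_mapMatrix M hM)
      (forall_notMem_badSet_mapMatrix v M hM)⟩

end Sextic

end Summit.Ventures.HodgeRepro2.T5SexticGaloisCMDiscriminant
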